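import Summits.Parity.GeneralizedHardyLittlewood.Theorems.PrimeLevelFamEdgeMomentsBeyondDiagonalDiagDecorPrimePowPair
import Summits.Parity.GeneralizedHardyLittlewood.Theorems.PrimeLevelFamEdgeMomentsBeyondDiagonalDiagDecorPrimePowPeelTriple
import HarnessLib

/-!
# Route `PrimeLevelFamEdge`, crux K_A `MomentsBeyondDiagonal` (stmt-Parity-20007), line «petersson_layers» v4, stub `stub_diag`:
# **the GENERIC triple family `P_{i+1}·P_{i′+1}·P_{i″+1}` of decorated coprime Selberg sums** (`c ≥ 2`; every `i, i′, i″`):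
# `Σ_{k≤y,(k,n)=1}τ(k)W(k)P_{i+1}P_{i′+1}P_{i″+1}(k)logᶜ(y/k) = −(A − X₁ − X₂ − X₃)·E_n·log^{c+i+i′+i″+1}y + O(D(n)(1+κ(n))(1+log y)^{c+i+i′+i″})`

`…DiagDecorPrimeSqSqPrimeFourth` (`P₂²P₄`) for arbitrary exponents: by the triple peel
`…DiagDecorPrimePowPeelTriple.sum_copTauW_mul_primePow_triple_eq` the sum is the `P_{i+i′+i″+3}`-peel (`…PrimePowTwo … (i+1+i′+1+i″)`)
plus three cross terms (`…DiagDecorCross.abs_decorCross_sub_le`): outer `log^{i+i′+2}p` with inner `P_{i″+1}`, outer `log^{i+i″+2}p`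
with inner `P_{i′+1}` (both `…PrimePowTwo`), outer `log^{i+1}p` with inner `P_{i′+1}P_{i″+1}` (`…DiagDecorPrimePowPair`). The leading
coefficient is left in the closed form the four inputs deliver. Bricks for the higher central-moment engines (`M₁₀ ∋ P₂²P₆, P₂P₄²`,
`M₁₂`, …) of the generic one-sided engine `…DiagDecorOneSidedCrudeFamily`.

* `abs_coprimeSumPow_primePowTriple_add_le` — **the displayed asymptotic**.

Def-free; theorems only. Helper `--supports stmt-Parity-20007`; closes nothing; K_A, K_B and the Parity summit are NOT proved;
nothing about Landau–Siegel zeros.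

## References
* E. Kowalski, P. Michel, J. VanderKam, J. reine angew. Math. 526 (2000), (23)–(28) pp. 13–15 and Prop. 5.1 p. 18.
  [cite: KowalskiMichelVanderKam2000, (23)–(28) — derivation (prime-power-log decorations of the Selberg coordinates)]
-/

noncomputable section

open scoped Real
open Finset ArithmeticFunction

namespace Summit.Parity.GeneralizedHardyLittlewood.Theorems.MomentsBeyondDiagonal.DiagKernel

open Literature.NumberTheory.LFunctions Literature.NumberTheory.LFunctions.KMV2000
open SelbergCoord (kappa)
open Summit.Parity.GeneralizedHardyLittlewood.Theorems.BeyondDiagonalBeatsQuarter.KernelFormXSq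
  (copTauW mainConst divWeight divWeight_nonneg mainConst_nonneg)
open Summit.Parity.GeneralizedHardyLittlewood.Theorems.MomentsBeyondDiagonal.DiagLines
  (sum_copTauW_mul_mul_sum_primeFactors_eq sum_copTauW_mul_primePow_triple_eq)

/-- Regrouping bookkeeping: `M₁ − (M₂ + M₃ + M₄) = M ⟹ A + X₁ + X₂ + X₃ + M = (A + M₁) + (X₁ − M₂) + (X₂ − M₃) + (X₃ − M₄)`.
[folklore] -/
private theorem regroup_four' {A X₁ X₂ X₃ M₁ M₂ M₃ M₄ M : ℝ} (h : M₁ - (M₂ + M₃ + M₄) = M) :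
    A + X₁ + X₂ + X₃ + M = (A + M₁) + (X₁ - M₂) + (X₂ - M₃) + (X₃ - M₄) := by
  rw [← h]; ring

/-- `|a + b + c + d| ≤ |a| + |b| + |c| + |d|`. [folklore] -/
private theorem abs_add_four_le' (a b c d : ℝ) : |a + b + c + d| ≤ |a| + |b| + |c| + |d| :=
  (abs_add_le _ _).trans (add_le_add ((abs_add_le _ _).trans (add_le_add (abs_add_le _ _) le_rfl)) le_rfl)

/-- **The `P_{i+1}P_{i′+1}P_{i″+1}`-decorated coprime Selberg sum** (`c ≥ 2`, every `i, i′, i″`): there is `C` with, for all `n ≥ 1`,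
`y ≥ 1`, `|Σ_{k≤y} a_n(k)·logᶜ(y/k)·P_{i+1}P_{i′+1}P_{i″+1}(k) + (A − (X₁ + X₂ + X₃))·E_n·log^{c+i+i′+i″+1}y| ≤ C·D(n)(1+κ(n))(1+log y)^{c+i+i′+i″}`
with the `P_{i+i′+i″+3}`-peel coefficient `A` and the three cross coefficients in the closed forms of `…PrimePowTwo`, `…PrimePowPair`
and `…DiagDecorCross`. [cite: KowalskiMichelVanderKam2000, (23)–(28) — derivation] -/
theorem abs_coprimeSumPow_primePowTriple_add_le (i i' i'' : ℕ) {c : ℕ} (hc : 2 ≤ c) :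
    ∃ C : ℝ, 0 < C ∧ ∀ n : ℕ, n ≠ 0 → ∀ y : ℝ, 1 ≤ y →
      |∑ k ∈ Icc 1 ⌊y⌋₊, copTauW n k * Real.log (y / k) ^ c *
          ((∑ p ∈ k.primeFactors, Real.log p ^ (i + 1)) * ((∑ p ∈ k.primeFactors, Real.log p ^ (i' + 1)) *
            ∑ p ∈ k.primeFactors, Real.log p ^ (i'' + 1))) +
          (2 * ((c : ℝ) * ((c : ℝ) - 1)) *
              (((i + 1 + i' + 1 + i'').factorial : ℝ) * (c - 2).factorial / (c + i + i' + i'' + 1).factorial) -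
            (2 * (2 * ((c : ℝ) * ((c : ℝ) - 1)) * ((i''.factorial : ℝ) * (c - 2).factorial / (c - 2 + i'' + 1).factorial)) *
                (((i + 1 + i').factorial : ℝ) * (c - 2 + i'' + 1).factorial / (c + i + i' + i'' + 1).factorial) +
              2 * (2 * ((c : ℝ) * ((c : ℝ) - 1)) * ((i'.factorial : ℝ) * (c - 2).factorial / (c - 2 + i' + 1).factorial)) *
                (((i + 1 + i'').factorial : ℝ) * (c - 2 + i' + 1).factorial / (c + i + i' + i'' + 1).factorial) +
              2 * (2 * ((c : ℝ) * ((c : ℝ) - 1)) * (((i' + 1 + i'').factorial : ℝ) * (c - 2).factorial /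
                    (c + i' + i'').factorial) -
                  2 * (2 * ((c : ℝ) * ((c : ℝ) - 1)) * ((i''.factorial : ℝ) * (c - 2).factorial /
                    (c - 2 + i'' + 1).factorial)) *
                    ((i'.factorial : ℝ) * (c - 2 + i'' + 1).factorial / (c + i' + i'').factorial)) *
                ((i.factorial : ℝ) * (c + i' + i'').factorial / (c + i + i' + i'' + 1).factorial))) *
            mainConst n * Real.log y ^ (c + i + i' + i'' + 1)| ≤
        C * divWeight n * (1 + kappa n) * (1 + Real.log y) ^ (c + i + i' + i'') := by
  obtain ⟨C₈, hC₈, h₈⟩ := abs_coprimeSumPow_primePow_add_le_of_two_le (i + 1 + i' + 1 + i'') hc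
  obtain ⟨C₄, hC₄, h₄⟩ := abs_coprimeSumPow_primePow_add_le_of_two_le i'' hc
  obtain ⟨C₂, hC₂, h₂⟩ := abs_coprimeSumPow_primePow_add_le_of_two_le i' hc
  obtain ⟨C₂₄, hC₂₄, h₂₄⟩ := abs_coprimeSumPow_primePowPair_add_le i' i'' hc
  have ep : c + i' + i'' = c + i' + i'' - 1 + 1 := by omega
  rw [ep] at h₂₄
  obtain ⟨C_A, hC_A, hXA⟩ := abs_decorCross_sub_le (fun k : ℕ ↦ ∑ p ∈ k.primeFactors, Real.log p ^ (i'' + 1))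
    (i + 1 + i') (c - 2 + i'') hC₄ h₄
  obtain ⟨C_B, hC_B, hXB⟩ := abs_decorCross_sub_le (fun k : ℕ ↦ ∑ p ∈ k.primeFactors, Real.log p ^ (i' + 1))
    (i + 1 + i'') (c - 2 + i') hC₂ h₂
  obtain ⟨C_C, hC_C, hXC⟩ := abs_decorCross_sub_le
    (fun k : ℕ ↦ (∑ p ∈ k.primeFactors, Real.log p ^ (i' + 1)) * ∑ p ∈ k.primeFactors, Real.log p ^ (i'' + 1)) i
    (c + i' + i'' - 1) hC₂₄ h₂₄
  refine ⟨C₈ + C_A + C_B + C_C, by positivity, fun n hn y hy ↦ ?_⟩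
  set N := ⌊y⌋₊ with hN
  have hP := h₈ n hn y hy
  have hA := hXA n hn y hy
  have hB := hXB n hn y hy
  have hCx := hXC n hn y hy
  beta_reduce at hA hB hCx
  -- normalise the exponents
  have e8a : c - 2 + (i + 1 + i' + 1 + i'') + 1 = c + i + i' + i'' + 1 := by omega
  have e8b : c - 2 + (i + 1 + i' + 1 + i'') = c + i + i' + i'' := by omega
  rw [e8a, e8b] at hP
  have eA1 : c - 2 + i'' + 1 + (i + 1 + i') + 1 = c + i + i' + i'' + 1 := by omega
  have eA2 : c - 2 + i'' + 1 + (i + 1 + i') = c + i + i' + i'' := by omega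
  rw [eA1, eA2] at hA
  have eB1 : c - 2 + i' + 1 + (i + 1 + i'') + 1 = c + i + i' + i'' + 1 := by omega
  have eB2 : c - 2 + i' + 1 + (i + 1 + i'') = c + i + i' + i'' := by omega
  rw [eB1, eB2] at hB
  have eC1 : c + i' + i'' - 1 + 1 + i + 1 = c + i + i' + i'' + 1 := by omega
  have eC2 : c + i' + i'' - 1 + 1 + i = c + i + i' + i'' := by omega
  have eC3 : c + i' + i'' - 1 + 1 = c + i' + i'' := by omega
  rw [eC1, eC2, eC3] at hCx
  -- decomposition `Σ aG·P P' P'' = peel + three cross terms`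
  have hpeel := sum_copTauW_mul_mul_sum_primeFactors_eq n N (fun k : ℕ ↦ Real.log (y / k) ^ c)
    (fun p : ℕ ↦ Real.log p ^ (i + 1 + i' + 1 + i'' + 1))
  have htri := sum_copTauW_mul_primePow_triple_eq n N (i + 1) (i' + 1) (i'' + 1) (fun k : ℕ ↦ Real.log (y / k) ^ c)
  beta_reduce at hpeel htri
  rw [show i + 1 + (i' + 1) + (i'' + 1) = i + 1 + i' + 1 + i'' + 1 by ring,
    show i + 1 + (i' + 1) = i + 1 + i' + 1 by ring, show i + 1 + (i'' + 1) = i + 1 + i'' + 1 by ring, ← hpeel] at htri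
  rw [htri]
  rw [regroup_four'
    (M₁ := 2 * ((c : ℝ) * ((c : ℝ) - 1)) *
      (((i + 1 + i' + 1 + i'').factorial : ℝ) * (c - 2).factorial / (c + i + i' + i'' + 1).factorial) *
      mainConst n * Real.log y ^ (c + i + i' + i'' + 1))
    (M₂ := 2 * (2 * ((c : ℝ) * ((c : ℝ) - 1)) * ((i''.factorial : ℝ) * (c - 2).factorial / (c - 2 + i'' + 1).factorial)) *
      (((i + 1 + i').factorial : ℝ) * (c - 2 + i'' + 1).factorial / (c + i + i' + i'' + 1).factorial) *
      mainConst n * Real.log y ^ (c + i + i' + i'' + 1))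
    (M₃ := 2 * (2 * ((c : ℝ) * ((c : ℝ) - 1)) * ((i'.factorial : ℝ) * (c - 2).factorial / (c - 2 + i' + 1).factorial)) *
      (((i + 1 + i'').factorial : ℝ) * (c - 2 + i' + 1).factorial / (c + i + i' + i'' + 1).factorial) *
      mainConst n * Real.log y ^ (c + i + i' + i'' + 1))
    (M₄ := 2 * (2 * ((c : ℝ) * ((c : ℝ) - 1)) * (((i' + 1 + i'').factorial : ℝ) * (c - 2).factorial /
          (c + i' + i'').factorial) -
        2 * (2 * ((c : ℝ) * ((c : ℝ) - 1)) * ((i''.factorial : ℝ) * (c - 2).factorial / (c - 2 + i'' + 1).factorial)) *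
          ((i'.factorial : ℝ) * (c - 2 + i'' + 1).factorial / (c + i' + i'').factorial)) *
      ((i.factorial : ℝ) * (c + i' + i'').factorial / (c + i + i' + i'' + 1).factorial) *
      mainConst n * Real.log y ^ (c + i + i' + i'' + 1))
    (by ring)]
  refine ((abs_add_four_le' _ _ _ _).trans (add_le_add (add_le_add (add_le_add hP hA) hB) hCx)).trans_eq ?_
  ring

end Summit.Parity.GeneralizedHardyLittlewood.Theorems.MomentsBeyondDiagonal.DiagKernel

end
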